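import Literature.AlgebraicGeometry.ShimuraVarieties.UnitaryBallSpecialCurveDatumOfCode
import Literature.AlgebraicGeometry.ShimuraVarieties.UnitaryBallLineStabFrame
import HarnessLib

/-!
# The level junction of the special curve datum, read over a subfield code (road (ii), leaf L3.3 (b))

Topic `AlgebraicGeometry/ShimuraVarieties`; namespace
`Literature.AlgebraicGeometry.ShimuraVarieties.UnitaryBallUniformisationDatum`.  THEOREMS ONLY (no definition, no named
fact, no instance).

`exists_specialCurveDatum_of_subfieldCode` (`UnitaryBallSpecialCurveDatumOfCode`) produces the special curve of the line
`W = D.E·(GL(e)B)e₃` of a coded piece datum `(D, e : L ≃+* D.E, D.H = H^e)` with its disc datum, under three JUNCTION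
hypotheses phrased in the datum's currency (`hΓ₁` congruence of the transported level, `hΓ₁Γ` / `hΓΓ₁` «`Γ₁` is the
restriction of the stabiliser `Γ_W` along the transported frame»).  The suppliers of these facts speak `L` / adelic
currency (`UnitaryGroupArithmeticLevels.isCongruenceSubgroup_arithmeticLevel`, `UnitaryGroupFrameEmbeddingLevels`,
`UnitaryGroupFrameStabiliserLevel`).  This file is the DICTIONARY, for a coded group `D.Γ = GL(e)(Γ_L)`:

* §1 `glMap_reindexGL_blockDiagGL_one`, `glMap_conj_blockDiag` — `GL(e)` commutes with `γ₁ ↦ B(γ₁ ⊕ 1)B⁻¹`;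
  `comp_mulVec_eq_map_mulVec_comp`, `comp_append_zero` — `e ∘ (M v) = M^e (e ∘ v)`, `e ∘ (x ⊕ 0) = (e ∘ x) ⊕ 0`;
* §2 `conj_blockDiag_mem_of_code` — `hΓ₁Γ` from `∀ γ₁ ∈ Γ₁L, B(γ₁ ⊕ 1)B⁻¹ ∈ Γ_L`;
* §3 `isCongruenceSubgroup_code_smul` — `hΓ₁` from `IsCongruenceSubgroup c J⋆ Γ₁L` (transport + rescaling by `a⁻¹`);
* §4 `exists_conj_blockDiag_of_code` — `hΓΓ₁` from the FRAME-FORM `L`-statement «every `δ ∈ Γ_L` mapping `B(L² ⊕ 0)` into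
  itself is `B(γ₁ ⊕ 1)B⁻¹` with `γ₁ ∈ Γ₁L`» (`UnitaryBallLineStabFrame.mem_lineStab_iff_mapsTo_frame` pulled back along `e`);
* §5 `exists_specialCurveDatum_of_subfieldCode'` — the head of `UnitaryBallSpecialCurveDatumOfCode` with the three junction
  hypotheses in `L`-currency;
* §6 `mem_lineStab_of_smul_eq_smul`, `hinj_of_exists_mem_lineStab_smul_eq` — the injectivity hypothesis `hinj` reduced, by
  FREENESS of the action (`UnitaryBallDiscontinuity.eq_one_of_smul_eq`), to a stabiliser witness `η ∈ Γ_W` with `γ z = η z`.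

References: N. Bergeron, J. Millson, C. Moeglin, Acta Math. 216 (2016), Part 2 §§1.2–1.4, 3.1; S. Kudla, *Seesaw dual reductive
pairs* (1984) §1; P. Deligne, *Travaux de Shimura* (1971), proof of Prop. 1.15.  Cell `hodgecm-mathlib`, road (ii) CUT-R2-5-FIELDS
leaf L3.3.  HC_CM is proved only modulo the 7 printed citations until rung 0 closes; nothing here is in a registered cone.
-/

set_option autoImplicit false

noncomputable section

open scoped ComplexOrder
open Matrix Complex NumberField Set Function CategoryTheory AlgebraicGeometry
open Literature.NumberTheory.Automorphic
open Literature.NumberTheory.Automorphic.UnitaryGroup (finSum reindexGL blockDiagGL coe_reindexGL coe_blockDiagGL)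
open Literature.NumberTheory.Transcendental Literature.AlgebraicGeometry.Motives

namespace Literature.AlgebraicGeometry.ShimuraVarieties

namespace UnitaryBallUniformisationDatum

variable {L : Type} [Field L] [NumberField L] [IsCMField L] (τ : L →+* ℂ)
  {X : SchemeOver ℂ} (D : UnitaryBallUniformisationDatum 2 X)
  (e : L ≃+* ↥D.E) (he : ∀ x : L, ((e x : ↥D.E) : ℂ) = τ x)

/-! ### §1 `GL(e)` and the block-diagonal conjugate -/

omit [NumberField L] [IsCMField L] in
/-- `GL(e)(γ₁ ⊕ 1) = GL(e)γ₁ ⊕ 1` in the concatenated basis. [cite: Kudla1984, §1] -/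
theorem glMap_reindexGL_blockDiagGL_one (γ₁ : GL (Fin 2) L) :
    Matrix.GeneralLinearGroup.map e.toRingHom (reindexGL finSumFinEquiv (blockDiagGL (γ₁, (1 : GL (Fin 1) L)))) =
      reindexGL finSumFinEquiv (blockDiagGL (Matrix.GeneralLinearGroup.map e.toRingHom γ₁, (1 : GL (Fin 1) ↥D.E))) := by
  refine Units.ext ?_
  rw [CodeField.coe_glMap_ringEquiv, coe_reindexGL, coe_reindexGL, coe_blockDiagGL, coe_blockDiagGL, Matrix.reindex_apply,
    Matrix.reindex_apply, ← Matrix.submatrix_map, Matrix.fromBlocks_map]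
  congr 2
  · exact (Matrix.map_zero _ (map_zero e)).symm ▸ rfl
  · exact (Matrix.map_zero _ (map_zero e)).symm ▸ rfl
  · rw [Units.val_one, Units.val_one, Matrix.map_one _ (map_zero e) (map_one e)]

omit [NumberField L] [IsCMField L] in
/-- `GL(e)(B(γ₁ ⊕ 1)B⁻¹) = GL(e)B·(GL(e)γ₁ ⊕ 1)·(GL(e)B)⁻¹`. [cite: Kudla1984, §1] -/
theorem glMap_conj_blockDiag (BL : GL (Fin 3) L) (γ₁ : GL (Fin 2) L) :
    Matrix.GeneralLinearGroup.map e.toRingHom (BL * reindexGL finSumFinEquiv (blockDiagGL (γ₁, (1 : GL (Fin 1) L))) * BL⁻¹) =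
      Matrix.GeneralLinearGroup.map e.toRingHom BL *
        reindexGL finSumFinEquiv (blockDiagGL (Matrix.GeneralLinearGroup.map e.toRingHom γ₁, (1 : GL (Fin 1) ↥D.E))) *
        (Matrix.GeneralLinearGroup.map e.toRingHom BL)⁻¹ := by
  rw [map_mul, map_mul, map_inv, glMap_reindexGL_blockDiagGL_one]

omit [NumberField L] [IsCMField L] in
/-- `e ∘ (M v) = M^e (e ∘ v)` (plumbing). [folklore] -/
private theorem comp_mulVec_eq_map_mulVec_comp {m n : Type*} [Fintype n] (M : Matrix m n L) (v : n → L) :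
    (⇑e ∘ (M *ᵥ v)) = M.map e *ᵥ (⇑e ∘ v) := by
  funext i
  exact RingHom.map_mulVec e.toRingHom M v i

omit [NumberField L] [IsCMField L] in
/-- `e ∘ (x ⊕ 0) = (e ∘ x) ⊕ 0` (plumbing). [folklore] -/
private theorem comp_append_zero (x : Fin 2 → L) :
    (⇑e ∘ Fin.append x (0 : Fin 1 → L)) = Fin.append (⇑e ∘ x) (0 : Fin 1 → ↥D.E) := by
  funext k
  induction k using Fin.addCases with
  | left i => rw [Function.comp_apply, Fin.append_left, Fin.append_left, Function.comp_apply]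
  | right j => rw [Function.comp_apply, Fin.append_right, Fin.append_right, Pi.zero_apply, Pi.zero_apply, map_zero]

omit [NumberField L] [IsCMField L] in
/-- `e.symm ∘ (e ∘ v) = v` (plumbing). [folklore] -/
private theorem symm_comp_comp {m : Type*} (v : m → L) : (⇑e.symm ∘ (⇑e ∘ v)) = v := by
  funext i; exact e.symm_apply_apply (v i)

omit [NumberField L] [IsCMField L] in
/-- `e ∘ (e.symm ∘ u) = u` (plumbing). [folklore] -/
private theorem comp_symm_comp {m : Type*} (u : m → ↥D.E) : (⇑e ∘ (⇑e.symm ∘ u)) = u := by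
  funext i; exact e.apply_symm_apply (u i)

/-! ### §2 `hΓ₁Γ` over the code -/

omit [NumberField L] [IsCMField L] in
/-- **`hΓ₁Γ` from `L`-currency**: if `B(γ₁ ⊕ 1)B⁻¹ ∈ Γ_L` for every `γ₁ ∈ Γ₁L` and `D.Γ = GL(e)(Γ_L)`, then
`GL(e)B·(GL(e)γ₁ ⊕ 1)·(GL(e)B)⁻¹ ∈ D.Γ` for every `γ₁ ∈ Γ₁L`. [cite: Kudla1984, §1] [cite: BergeronMillsonMoeglin2016Balls, Part 2 §1.4] -/
theorem conj_blockDiag_mem_of_code {ΓL : Subgroup (GL (Fin 3) L)}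
    (hΓ : D.Γ = ΓL.map (Matrix.GeneralLinearGroup.map e.toRingHom)) (BL : GL (Fin 3) L) {Γ₁L : Subgroup (GL (Fin 2) L)}
    (h : ∀ γ₁ ∈ Γ₁L, BL * reindexGL finSumFinEquiv (blockDiagGL (γ₁, (1 : GL (Fin 1) L))) * BL⁻¹ ∈ ΓL) :
    ∀ γ₁ ∈ Γ₁L, Matrix.GeneralLinearGroup.map e.toRingHom BL *
      reindexGL finSumFinEquiv (blockDiagGL (Matrix.GeneralLinearGroup.map e.toRingHom γ₁, (1 : GL (Fin 1) ↥D.E))) *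
      (Matrix.GeneralLinearGroup.map e.toRingHom BL)⁻¹ ∈ D.Γ := by
  intro γ₁ hγ₁
  rw [hΓ, ← glMap_conj_blockDiag]
  exact ⟨_, h γ₁ hγ₁, rfl⟩

/-! ### §3 `hΓ₁` over the code -/

omit [NumberField L] [IsCMField L] in
/-- `(c • M)^e = e(c) • M^e` (plumbing). [folklore] -/
private theorem map_smul_ringEquiv {m k : Type*} (c : L) (M : Matrix m k L) : (c • M).map e = e c • M.map e := by
  ext i j; simp [Matrix.map_apply, map_mul]

include he in
/-- **`hΓ₁` from `L`-currency**: a congruence subgroup `Γ₁L` of `U(J⋆)(L)` transports to a congruence subgroup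
`GL(e)(Γ₁L)` of `U((a⁻¹J⋆)^e)` over `D.E` (`PicardCM.isCongruenceSubgroup_map` and the rescaling
`isCongruenceSubgroup_smul_iff`). [cite: BergeronMillsonMoeglin2016Balls, Part 2 §1.4] -/
theorem isCongruenceSubgroup_code_smul (Jstar : Matrix (Fin 2) (Fin 2) L) {Γ₁L : Subgroup (GL (Fin 2) L)} {a : L}
    (ha : a ≠ 0) (h : IsCongruenceSubgroup (IsCMField.complexConj L).toRingEquiv.toRingHom Jstar Γ₁L) :
    IsCongruenceSubgroup (conjRingHom D.E) ((a⁻¹ • Jstar).map e) (Γ₁L.map (Matrix.GeneralLinearGroup.map e.toRingHom)) := by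
  have hσ : ∀ x, conjRingHom D.E (e x) = e ((IsCMField.complexConj L).toRingEquiv.toRingHom x) :=
    fun x => CodeField.conjRingHom_ringEquiv_apply τ e he x
  have h1 := PicardCM.isCongruenceSubgroup_map e hσ Jstar h
  rw [map_smul_ringEquiv]
  exact (isCongruenceSubgroup_smul_iff (conjRingHom D.E) ((map_ne_zero e).2 (inv_ne_zero ha)) _ _).2 h1

/-! ### §4 `hΓΓ₁` over the code -/

include he in
/-- **`hΓΓ₁` from the frame-form `L`-statement.**  Let `D.Γ = GL(e)(Γ_L)`, `D.H = H^e`, `ᵗc(B)·(a•H)·B = J⋆ ⊕ᶠ J⊥` over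
`L`.  If every `δ ∈ Γ_L` mapping `B(L² ⊕ 0)` into itself is `B(γ₁ ⊕ 1)B⁻¹` with `γ₁ ∈ Γ₁L` (the conclusion of
`UnitaryGroupFrameStabiliserLevel` at a `B`-adapted neat level), then every element of the stabiliser `Γ_W`,
`W = D.E·(GL(e)B)e₃`, is `GL(e)B·(GL(e)γ₁ ⊕ 1)·(GL(e)B)⁻¹` with `γ₁ ∈ Γ₁L`
(`UnitaryBallLineStabFrame.mem_lineStab_iff_mapsTo_frame` pulled back along `e`).
[cite: Deligne1971TravauxShimura, Prop. 1.15 (proof, p. 132)] [cite: KudlaMillson1990, Lemma 1.1, p. 128] -/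
theorem exists_conj_blockDiag_of_code {ΓL : Subgroup (GL (Fin 3) L)}
    (hΓ : D.Γ = ΓL.map (Matrix.GeneralLinearGroup.map e.toRingHom))
    {Hm : Matrix (Fin 3) (Fin 3) L} (hH : D.H = Hm.map e.toRingHom) (BL : GL (Fin 3) L) {a : L} (ha : a ≠ 0)
    (Jstar : Matrix (Fin 2) (Fin 2) L) (Jperp : Matrix (Fin 1) (Fin 1) L)
    (hBL : formCongr (IsCMField.complexConj L).toRingEquiv.toRingHom BL (a • Hm) = finSum 2 1 Jstar Jperp)
    {Γ₁L : Subgroup (GL (Fin 2) L)}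
    (h : ∀ δ ∈ ΓL,
      (∀ x : Fin 2 → L, ∃ y : Fin 2 → L,
        ((δ : GL (Fin 3) L) : Matrix (Fin 3) (Fin 3) L) *ᵥ ((BL : Matrix (Fin 3) (Fin 3) L) *ᵥ Fin.append x (0 : Fin 1 → L)) =
          (BL : Matrix (Fin 3) (Fin 3) L) *ᵥ Fin.append y (0 : Fin 1 → L)) →
      ∃ γ₁ ∈ Γ₁L, δ = BL * reindexGL finSumFinEquiv (blockDiagGL (γ₁, (1 : GL (Fin 1) L))) * BL⁻¹) :
    ∀ γ : D.Γ, γ ∈ D.lineStab (D.E ∙ fun i =>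
        ((Matrix.GeneralLinearGroup.map e.toRingHom BL : GL (Fin 3) ↥D.E) : Matrix (Fin 3) (Fin 3) ↥D.E) i (Fin.last 2)) →
      ∃ γ₁ ∈ Γ₁L, (γ : GL (Fin 3) ↥D.E) = Matrix.GeneralLinearGroup.map e.toRingHom BL *
        reindexGL finSumFinEquiv (blockDiagGL (Matrix.GeneralLinearGroup.map e.toRingHom γ₁, (1 : GL (Fin 1) ↥D.E))) *
        (Matrix.GeneralLinearGroup.map e.toRingHom BL)⁻¹ := by
  intro γ hγ
  -- `γ = GL(e) δ` with `δ ∈ Γ_L`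
  have hmem : (γ : GL (Fin 3) ↥D.E) ∈ ΓL.map (Matrix.GeneralLinearGroup.map e.toRingHom) := hΓ ▸ γ.2
  obtain ⟨δ, hδ, hδγ⟩ := hmem
  -- frame form over `D.E`
  have hB' := D.formCongr_glMap_code_eq_finSum τ e he hH BL ha Jstar Jperp hBL
  have hframe := (D.mem_lineStab_iff_mapsTo_frame (Matrix.GeneralLinearGroup.map e.toRingHom BL) _ _ hB' γ).1 hγ
  -- pulled back to `L`
  have hL : ∀ x : Fin 2 → L, ∃ y : Fin 2 → L,
      ((δ : GL (Fin 3) L) : Matrix (Fin 3) (Fin 3) L) *ᵥ ((BL : Matrix (Fin 3) (Fin 3) L) *ᵥ Fin.append x (0 : Fin 1 → L)) =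
        (BL : Matrix (Fin 3) (Fin 3) L) *ᵥ Fin.append y (0 : Fin 1 → L) := by
    intro x
    obtain ⟨y, hy⟩ := hframe (⇑e ∘ x)
    refine ⟨⇑e.symm ∘ y, ?_⟩
    have hinj : Function.Injective (fun v : Fin 3 → L => (⇑e ∘ v)) := fun v w hvw => by
      simpa only [symm_comp_comp] using congrArg (fun u => (⇑e.symm ∘ u)) hvw
    apply hinj
    change (⇑e ∘ _) = (⇑e ∘ _)
    rw [comp_mulVec_eq_map_mulVec_comp, comp_mulVec_eq_map_mulVec_comp, comp_mulVec_eq_map_mulVec_comp, comp_append_zero,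
      comp_append_zero, comp_symm_comp, ← CodeField.coe_glMap_ringEquiv e BL, ← hy, ← hδγ, ← CodeField.coe_glMap_ringEquiv e δ]
  obtain ⟨γ₁, hγ₁, hδeq⟩ := h δ hδ hL
  refine ⟨γ₁, hγ₁, ?_⟩
  rw [← hδγ, hδeq, glMap_conj_blockDiag]

/-! ### §5 The head with the junction in `L`-currency -/

include he in
/-- **The special curve datum of a coded piece, junction hypotheses in `L`-currency** — `exists_specialCurveDatum_of_subfieldCode`
with `hΓ₁` / `hΓ₁Γ` / `hΓΓ₁` replaced by: `Γ₁L` a congruence subgroup of `U(J⋆)(L)`; `B(γ₁ ⊕ 1)B⁻¹ ∈ Γ_L` for `γ₁ ∈ Γ₁L`; every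
`δ ∈ Γ_L` stabilising `B(L² ⊕ 0)` is `B(γ₁ ⊕ 1)B⁻¹` with `γ₁ ∈ Γ₁L` (where `D.Γ = GL(e)(Γ_L)`).
[cite: BergeronMillsonMoeglin2016Balls, Part 2 §§3.1–3.3] [cite: KudlaMillson1990, Lemma 1.1, p. 128 and p. 133]
[cite: Liu2021, proof of Thm. 4.15 l. 2207] -/
theorem exists_specialCurveDatum_of_subfieldCode' {ΓL : Subgroup (GL (Fin 3) L)}
    (hΓ : D.Γ = ΓL.map (Matrix.GeneralLinearGroup.map e.toRingHom))
    {Hm : Matrix (Fin 3) (Fin 3) L} (hH : D.H = Hm.map e.toRingHom) (BL : GL (Fin 3) L) {a : L} (ha : a ≠ 0)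
    (Jstar : Matrix (Fin 2) (Fin 2) L) (Jperp : Matrix (Fin 1) (Fin 1) L)
    (hBL : formCongr (IsCMField.complexConj L).toRingEquiv.toRingHom BL (a • Hm) = finSum 2 1 Jstar Jperp)
    (𝔣 : D.SylvesterFrame) (hτa : 0 < (τ a).re) (hτa' : (τ a).im = 0) (hpos : 0 < (τ (Jperp 0 0)).re)
    (Γ₁L : Subgroup (GL (Fin 2) L)) (hΓ₁L : IsCongruenceSubgroup (IsCMField.complexConj L).toRingEquiv.toRingHom Jstar Γ₁L)
    (hΓ₁Γ : ∀ γ₁ ∈ Γ₁L, BL * reindexGL finSumFinEquiv (blockDiagGL (γ₁, (1 : GL (Fin 1) L))) * BL⁻¹ ∈ ΓL)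
    (hΓΓ₁ : ∀ δ ∈ ΓL,
      (∀ x : Fin 2 → L, ∃ y : Fin 2 → L,
        ((δ : GL (Fin 3) L) : Matrix (Fin 3) (Fin 3) L) *ᵥ ((BL : Matrix (Fin 3) (Fin 3) L) *ᵥ Fin.append x (0 : Fin 1 → L)) =
          (BL : Matrix (Fin 3) (Fin 3) L) *ᵥ Fin.append y (0 : Fin 1 → L)) →
      ∃ γ₁ ∈ Γ₁L, δ = BL * reindexGL finSumFinEquiv (blockDiagGL (γ₁, (1 : GL (Fin 1) L))) * BL⁻¹)
    (hinj : ∀ γ : D.Γ, (∃ z ∈ D.specialBall 𝔣 {fun i =>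
        ((Matrix.GeneralLinearGroup.map e.toRingHom BL : GL (Fin 3) ↥D.E) : Matrix (Fin 3) (Fin 3) ↥D.E) i (Fin.last 2)},
        D.ballRep 𝔣 γ • z ∈ D.specialBall 𝔣 {fun i =>
          ((Matrix.GeneralLinearGroup.map e.toRingHom BL : GL (Fin 3) ↥D.E) : Matrix (Fin 3) (Fin 3) ↥D.E) i (Fin.last 2)}) →
      γ ∈ D.lineStab (D.E ∙ fun i =>
        ((Matrix.GeneralLinearGroup.map e.toRingHom BL : GL (Fin 3) ↥D.E) : Matrix (Fin 3) (Fin 3) ↥D.E) i (Fin.last 2))) :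
    ∃ (Z : SchemeOver ℂ) (κ : Z ⟶ X) (_ : IsClosedImmersion κ.left) (_ : IsReduced Z.left)
      (B₁ : UnitaryBallUniformisationDatum 1 Z),
      B₁.Hℂ = ((τ a)⁻¹ : ℂ) • Jstar.map τ ∧
      B₁.Γ.map (Matrix.GeneralLinearGroup.map (B₁.τ₁ : ↥B₁.E →+* ℂ)) = Γ₁L.map (Matrix.GeneralLinearGroup.map τ) ∧
      (∀ v ∈ negCone (Jstar.map τ),
        AlgPoints.map κ (B₁.unif v) = D.unif (((BL : Matrix (Fin 3) (Fin 3) L).map τ) *ᵥ Fin.append v (0 : Fin 1 → ℂ))) ∧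
      ∀ P : ComplexPoints X, P.pt ∈ Set.range ⇑κ.left ↔
        P ∈ D.unif '' subCone D.Hℂ ((fun w ↦ D.τ₁ ∘ w) ''
          ((D.E ∙ fun i => ((Matrix.GeneralLinearGroup.map e.toRingHom BL : GL (Fin 3) ↥D.E) :
            Matrix (Fin 3) (Fin 3) ↥D.E) i (Fin.last 2) : Submodule ↥D.E (Fin 3 → ↥D.E)) : Set (Fin 3 → ↥D.E))) :=
  D.exists_specialCurveDatum_of_subfieldCode τ e he hH BL ha Jstar Jperp hBL 𝔣 hτa hτa' hpos Γ₁L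
    (D.isCongruenceSubgroup_code_smul τ e he Jstar ha hΓ₁L)
    (D.conj_blockDiag_mem_of_code e hΓ BL hΓ₁Γ)
    (D.exists_conj_blockDiag_of_code τ e he hΓ hH BL ha Jstar Jperp hBL hΓΓ₁)
    hinj

/-! ### §6 The injectivity hypothesis `hinj`, reduced to a witness in the stabiliser (freeness) -/

/-- **`hinj` reduction by FREENESS**: if `γ z = η z` on the ball for some `η` in the stabiliser `Γ_W`, then `γ ∈ Γ_W` — because
`Γ` acts freely (`UnitaryBallDiscontinuity.eq_one_of_smul_eq`), `γ = η`.  (The analytic seam «F-INJ ⇒ such an `η` exists for every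
`γ` moving a point of `𝔹_W` into `𝔹_W`», with `η = B′(γ₁ ⊕ 1)B′⁻¹ ∈ Γ_W` by `UnitaryBallLineStabFrame.conj_blockDiagGL_mem_lineStab`,
is the Shimura-set bookkeeping of the road (ii) head.) [cite: BergeronMillsonMoeglin2016Balls, Introduction §1.1 and Part 2 §3.3] -/
theorem mem_lineStab_of_smul_eq_smul (𝔣 : D.SylvesterFrame) {W : Submodule ↥D.E (Fin 3 → ↥D.E)} {γ η : D.Γ}
    (hη : η ∈ D.lineStab W) {z : Literature.Geometry.ComplexHyperbolic.BallModel.Ball}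
    (h : D.ballRep 𝔣 γ • z = D.ballRep 𝔣 η • z) : γ ∈ D.lineStab W := by
  have h1 : D.ballRep 𝔣 (η⁻¹ * γ) • z = z := by
    rw [map_mul, map_inv, mul_smul, h, inv_smul_smul]
  have h2 : η⁻¹ * γ = 1 := D.eq_one_of_smul_eq 𝔣 h1
  rw [inv_mul_eq_one] at h2
  rw [← h2]
  exact hη

/-- **`hinj` from stabiliser witnesses**: if for every `γ ∈ Γ` moving a point of the special sub-ball `𝔹_W` into `𝔹_W` there is
`η ∈ Γ_W` with `γ z = η z` for some ball point `z`, then the injectivity hypothesis `hinj` of `exists_specialCurveDatum` holds.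
[cite: BergeronMillsonMoeglin2016Balls, Part 2 §3.3] -/
theorem hinj_of_exists_mem_lineStab_smul_eq (𝔣 : D.SylvesterFrame) (s : Fin 3 → ↥D.E)
    (h : ∀ γ : D.Γ, (∃ z ∈ D.specialBall 𝔣 {s}, D.ballRep 𝔣 γ • z ∈ D.specialBall 𝔣 {s}) →
      ∃ η ∈ D.lineStab (D.E ∙ s), ∃ z : Literature.Geometry.ComplexHyperbolic.BallModel.Ball,
        D.ballRep 𝔣 γ • z = D.ballRep 𝔣 η • z) :
    ∀ γ : D.Γ, (∃ z ∈ D.specialBall 𝔣 {s}, D.ballRep 𝔣 γ • z ∈ D.specialBall 𝔣 {s}) → γ ∈ D.lineStab (D.E ∙ s) := by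
  intro γ hγ
  obtain ⟨η, hη, z, hz⟩ := h γ hγ
  exact D.mem_lineStab_of_smul_eq_smul 𝔣 hη hz

end UnitaryBallUniformisationDatum

end Literature.AlgebraicGeometry.ShimuraVarieties

end
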